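import Summits.PneNP.PneNP.Theorems.ReslinSizeFromWidthPCDegreeConsequences
import Literature.Computability.MetaComplexity.GraphOrderingPrincipleDegree
import HarnessLib

/-!
# PneNP / ReslinSizeFromWidth — the PC rail with its first printed input: graph ordering principles (conditional on Galesi–Lauria 2010)

Helper file for the INPUT side of crux `ResLinSizeFromWidth` (stmt-PneNP-18932).  The PC rail
(`ReslinSizeFromWidthPCDegree.lean`: no PC/`𝔽₂` refutation of degree `≤ d` ⇒ every Res(⊕)
refutation has rank-width `≥ d`; `…Consequences.lean`: clause space, tree-like and quadratic
dag-like size) had no input in the tree.  This file plugs in the first printed one, as a NAMED FACT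
(`GalesiLauria2010_PC_GOP_degree`, `Literature/…/GraphOrderingPrincipleDegree.lean`: Galesi–Lauria
ToCL 2010 Thm 1 — over an `(r, c)`-vertex expander `G`, GL10's graph ordering principle `GOP(G)` has
no PC refutation of degree `≤ cr/4` over any field), via the bridge `cnfPolys K φ = PC.ofCNF K φ`
between the Summits-side translation (`PolyCalc.cnfPolys`, route ExpanderLinearGenerators) and its
Literature copy (`PolynomialCalculusCNF.lean`).  CONDITIONAL results (hypothesis `hGL`; the gate
records `proof.conditional`): for `G` on `Fin n` an `(r, c)`-vertex expander (`r ≥ 1`, `c > 0`) of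
maximum degree `≤ t`, `3 ≤ t`, and an integer `d ≤ cr/4`,

* every Res(⊕) refutation (semantic weakening) of `GOP(G)` has a line of rank `≥ d`
  (`resLinWidth_glGOP`, `le_minResLinWidth_glGOP`) — the rank form of "large PC degree ⇒ large
  Res(⊕) width" [Gryaznov–Ovcharov–Riazanov 2024, after Thm 7];
* every configuration-style Res(⊕) refutation of `GOP(G)` has clause space `≥ d + 1 - t`
  (`clauseSpace_glGOP`) — GOR's Corollary 2 ("Space(GOP(G)) ≥ δs/4 − d") in the tree's constants;
* every tree-like Res(⊕) refutation has `≥ 2^(d-t-1)` lines (`treeLike_length_glGOP`) and every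
  Res(⊕) refutation `π` has `2 + (d-1)d ≤ 2|π| + t(t+1)` (`quadratic_length_glGOP`).

Not here: GOR's Thm 9 (`Space(Ordering_n) = Ω(n)`, which needs the projection of `Ordering_n` onto
`GOP(G)` and explicit vertex expanders), Mikša–Nordström's FPHP bound (GOR Thm 10/11; source not
held), any discharge of the named fact.

References: N. Galesi, M. Lauria, ACM ToCL 12(1) (2010), Thm 1; S. Gryaznov, S. Ovcharov,
A. Riazanov, ACM ToCT (2024), §4.1 (Thm 8, Cor. 2, Thm 9).
-/

noncomputable section

namespace Summit.PneNP.PneNP.Theorems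

-- `Summit.PneNP.PneNP` repeats a path component by design (summit = sub-problem); silence the linter.
set_option linter.dupNamespace false

open Literature.Computability.Complexity Literature.Computability.MetaComplexity
open Summit.PneNP.PneNP.Theorems.PolyCalc

/-- **Bridge**: the Summits-side clause translation (route ExpanderLinearGenerators) and its
Literature copy are the same polynomials. -/
theorem PolyCalc.unsatPolyK_eq_ofClause (K : Type*) [Field K] (C : Clause ℕ) :
    unsatPolyK K C = PC.ofClause K C := rfl

/-- **Bridge**: `cnfPolys K φ = PC.ofCNF K φ`. -/
theorem PolyCalc.cnfPolys_eq_ofCNF (K : Type*) [Field K] (φ : CNF ℕ) :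
    cnfPolys K φ = PC.ofCNF K φ := rfl

namespace ResLinPC

variable {n : ℕ} (G : SimpleGraph (Fin n)) [DecidableRel G.Adj] {r : ℕ} {c : ℝ} {t d : ℕ}

/-- Under GL10 Thm 1: the clause polynomials of `GOP(G)` over `𝔽₂` have no PC refutation of degree
`≤ d` whenever `d ≤ cr/4`. [Galesi–Lauria 2010, Thm 1 — hypothesis] -/
theorem not_refutableInDegree_glGOP (hGL : GalesiLauria2010_PC_GOP_degree) (hr : 1 ≤ r)
    (hc : 0 < c) (hG : IsVertexExpander G r c) (hd : (d : ℝ) ≤ c * r / 4) :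
    ¬ PC.RefutableInDegree (cnfPolys (ZMod 2) (GOP.glGOP G)) d := by
  rw [PolyCalc.cnfPolys_eq_ofCNF]
  exact hGL.not_refutable (ZMod 2) G hr hc hG hd

/-- **Res(⊕) rank of graph ordering principles** (conditional on GL10 Thm 1): over an
`(r, c)`-vertex expander of maximum degree `≤ d` with `3 ≤ d ≤ cr/4`, every Res(⊕) refutation of
`GOP(G)` contains a line of rank `≥ d`. [Gryaznov–Ovcharov–Riazanov 2024, §4.1 (large PC degree ⇒
large Res(⊕) width); the rail `resLin_rank_of_pcDegree`] -/
theorem resLinWidth_glGOP (hGL : GalesiLauria2010_PC_GOP_degree) (hr : 1 ≤ r) (hc : 0 < c)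
    (hG : IsVertexExpander G r c) (h3 : 3 ≤ d) (hdeg : ∀ u, G.degree u ≤ d)
    (hd : (d : ℝ) ≤ c * r / 4) {π : List ResLinLine} (hπ : IsResLinRefutation (GOP.glGOP G) π) :
    d ≤ resLinWidth π :=
  resLin_rank_of_pcDegree (GOP.isWidthLE_glGOP G h3 hdeg)
    (not_refutableInDegree_glGOP G hGL hr hc hG hd) hπ

/-- The same for the minimal refutation width (`ℕ∞`). -/
theorem le_minResLinWidth_glGOP (hGL : GalesiLauria2010_PC_GOP_degree) (hr : 1 ≤ r) (hc : 0 < c)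
    (hG : IsVertexExpander G r c) (h3 : 3 ≤ d) (hdeg : ∀ u, G.degree u ≤ d)
    (hd : (d : ℝ) ≤ c * r / 4) : (d : ℕ∞) ≤ minResLinWidth (GOP.glGOP G) :=
  le_minResLinWidth_iff.2 fun _ hπ => resLinWidth_glGOP G hGL hr hc hG h3 hdeg hd hπ

/-- **Res(⊕) clause space of graph ordering principles** (GOR Cor. 2 in the tree's constants,
conditional on GL10 Thm 1): maximum degree `≤ t`, `3 ≤ t < d ≤ cr/4` ⇒ every configuration-style
Res(⊕) refutation of `GOP(G)` has clause space `≥ d + 1 - t`. [Gryaznov–Ovcharov–Riazanov 2024,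
Cor. 2 ("Space(GOP(G)) ≥ δs/4 − d")] -/
theorem clauseSpace_glGOP (hGL : GalesiLauria2010_PC_GOP_degree) (hr : 1 ≤ r) (hc : 0 < c)
    (hG : IsVertexExpander G r c) (h3 : 3 ≤ t) (hdeg : ∀ u, G.degree u ≤ t) (htd : t + 1 ≤ d)
    (hd : (d : ℝ) ≤ c * r / 4) {ϖ : List (Finset LinClause)}
    (hϖ : IsResLinSpaceRefutation (GOP.glGOP G) ϖ) : d + 1 - t ≤ resLinClauseSpace ϖ :=
  clauseSpace_of_pcDegree (GOP.isWidthLE_glGOP G h3 hdeg) htd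
    (not_refutableInDegree_glGOP G hGL hr hc hG hd) hϖ

/-- **Tree-like Res(⊕) size of graph ordering principles** (conditional on GL10 Thm 1): maximum
degree `≤ t`, `3 ≤ t ≤ d ≤ cr/4` ⇒ every tree-like Res(⊕) refutation of `GOP(G)` has at least
`2^(d - t - 1)` lines. [Efremenko–Garlík–Itsykson 2024, §1.1.1 (the method)] -/
theorem treeLike_length_glGOP (hGL : GalesiLauria2010_PC_GOP_degree) (hr : 1 ≤ r) (hc : 0 < c)
    (hG : IsVertexExpander G r c) (h3 : 3 ≤ t) (hdeg : ∀ u, G.degree u ≤ t) (htd : t ≤ d)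
    (hd : (d : ℝ) ≤ c * r / 4) {π : List ResLinLine} (hπ : IsResLinRefutation (GOP.glGOP G) π)
    (htree : ∀ i : ℕ, (π.map fun l => l.premises.count i).sum ≤ 1) : 2 ^ (d - t - 1) ≤ π.length :=
  treeLike_length_of_pcDegree (GOP.isWidthLE_glGOP G h3 hdeg) htd
    (not_refutableInDegree_glGOP G hGL hr hc hG hd) hπ htree

/-- **Dag-like Res(⊕) size of graph ordering principles, quadratic law** (conditional on GL10
Thm 1): `2 + (d-1)·d ≤ 2·|π| + t·(t+1)` for every Res(⊕) refutation `π` of `GOP(G)`. -/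
theorem quadratic_length_glGOP (hGL : GalesiLauria2010_PC_GOP_degree) (hr : 1 ≤ r) (hc : 0 < c)
    (hG : IsVertexExpander G r c) (h3 : 3 ≤ t) (hdeg : ∀ u, G.degree u ≤ t) (htd : t + 1 ≤ d)
    (hd : (d : ℝ) ≤ c * r / 4) {π : List ResLinLine} (hπ : IsResLinRefutation (GOP.glGOP G) π) :
    2 + (d - 1) * d ≤ 2 * π.length + t * (t + 1) :=
  quadratic_length_of_pcDegree (GOP.isWidthLE_glGOP G h3 hdeg) htd
    (not_refutableInDegree_glGOP G hGL hr hc hG hd) hπ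

end ResLinPC

end Summit.PneNP.PneNP.Theorems
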